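import Literature.AnabelianGeometry.SemiGraphs.FundamentalGroup
import Mathlib.Data.Countable.Basic

/-!
# Countability of the fundamental groupoid of a countable semi-graph (proofs)

Proof-only file.  For a countable semi-graph `𝔾` ([SemiAnbd] §1 p. 11: countably many vertices and
edges) the hom-sets of the fundamental groupoid `Π(𝔾)` (`FundamentalGroup.lean`) are countable:
branches are countable (each edge has two), hence so are the arrows of `Cat(𝔾)` and of its
symmetrisation, hence the paths, hence their classes in the free groupoid.  This is the countability
of the fibres of the universal graph-covering `𝔾̃ → 𝔾` ([SemiAnbd] p. 15; `UniversalCovering.lean`)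
needed to see them as objects of `B^temp` (countable discrete sets, [SemiAnbd] §3 p. 33) in the
construction of the tempered fundamental group ([SemiAnbd] Prop. 3.6, p. 38).
-/

namespace Literature.AnabelianGeometry.SemiGraphs

namespace SemiGraph

open CategoryTheory

universe v u

/-- Paths in a quiver with countably many vertices and countably many arrows between any two
vertices are countable (inject a path into the list of its arrows). [folklore] -/
private theorem countable_path {V : Type u} [Quiver.{v} V] [Countable V]
    [∀ x y : V, Countable (x ⟶ y)] (a b : V) : Countable (Quiver.Path a b) := by
  classical
  -- the list of arrows of a path, last arrow first
  let L : ∀ {b : V}, Quiver.Path a b → List (Σ x y : V, (x ⟶ y)) :=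
    fun p => by
      induction p with
      | nil => exact []
      | cons p e ih => exact ⟨_, _, e⟩ :: ih
  have hL : ∀ {b : V} (p q : Quiver.Path a b), L p = L q → p = q := by
    intro b p
    induction p with
    | nil =>
      intro q hq
      cases q with
      | nil => rfl
      | cons q e => exact absurd hq (by simp [L])
    | cons p e ih =>
      intro q hq
      cases q with
      | nil => exact absurd hq (by simp [L])
      | cons q e' =>
        simp only [L, List.cons.injEq] at hq
        obtain ⟨h1, h2⟩ := hq
        obtain ⟨rfl, h1'⟩ := Sigma.mk.inj_iff.mp h1
        obtain ⟨-, h1''⟩ := Sigma.mk.inj_iff.mp (eq_of_heq h1')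
        obtain rfl := eq_of_heq h1''
        rw [ih q h2]
  exact Function.Injective.countable (f := fun p : Quiver.Path a b => L p) fun p q h => hL p q h

/-- The branches of a countable semi-graph form a countable set (every edge has exactly two).
[cite: MochizukiSemiAnbd2006, §1 p.11] -/
theorem countable_branch (G : SemiGraph.{u}) (hG : G.IsCountable) : Countable G.Branch := by
  classical
  haveI := hG.countable_edge
  -- the branches of a fixed edge: at most (exactly) two
  have hfin : ∀ e : G.Edge, Finite {b : G.Branch // G.edgeOf b = e} := by
    intro e
    obtain ⟨b₁, b₂, -, h₁, h₂, hall⟩ := G.two_branches e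
    refine Finite.of_surjective (fun i : Bool => if i then (⟨b₁, h₁⟩ : {b // G.edgeOf b = e})
      else ⟨b₂, h₂⟩) ?_
    rintro ⟨b, hb⟩
    rcases hall b hb with rfl | rfl
    · exact ⟨true, rfl⟩
    · exact ⟨false, rfl⟩
  haveI : ∀ e, Countable {b : G.Branch // G.edgeOf b = e} := fun e => inferInstance
  have : Countable (Σ e : G.Edge, {b : G.Branch // G.edgeOf b = e}) := inferInstance
  exact Function.Injective.countable
    (f := fun b : G.Branch => (⟨G.edgeOf b, b, rfl⟩ : Σ e : G.Edge, {b : G.Branch // G.edgeOf b = e}))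
    fun b₁ b₂ h => by
      have := congrArg (fun s : (Σ e : G.Edge, {b : G.Branch // G.edgeOf b = e}) => s.2.1) h
      exact this

/-- The arrows of `Cat(𝔾)` between two components of a countable semi-graph are countable.
[cite: MochizukiSemiAnbd2006, Def. 2.11 p.32] -/
theorem countable_catArrow (G : SemiGraph.{u}) (hG : G.IsCountable) (x y : G.CatCarrier) :
    Countable (x ⟶ y) := by
  haveI := G.countable_branch hG
  rcases x with v | e <;> rcases y with v' | e'
  · exact inferInstanceAs (Countable PEmpty.{u + 1})
  · exact inferInstanceAs (Countable PEmpty.{u + 1})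
  · exact inferInstanceAs (Countable {b : G.Branch // G.edgeOf b = e ∧ G.abuts b = some v'})
  · exact inferInstanceAs (Countable PEmpty.{u + 1})

/-- **The hom-sets of the fundamental groupoid of a countable semi-graph are countable** (hence so
are the fibres of the universal graph-covering, [SemiAnbd] p. 15, and `π₁(𝔾, c)` itself).
[cite: MochizukiSemiAnbd2006, §1 p.15] -/
theorem countable_hom_fundamentalGroupoid (G : SemiGraph.{u}) (hG : G.IsCountable)
    (x y : G.CatCarrier) : Countable (G.basept x ⟶ G.basept y) := by
  haveI := hG.countable_vertex
  haveI := hG.countable_edge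
  haveI hC : Countable G.CatCarrier := by
    change Countable (G.Vertex ⊕ G.Edge)
    infer_instance
  haveI hA : ∀ a b : G.CatCarrier, Countable (a ⟶ b) := G.countable_catArrow hG
  -- arrows of the symmetrised quiver `Symmetrify Cat(𝔾)` are pairs of opposite arrows
  haveI hS : ∀ a b : Quiver.Symmetrify G.CatCarrier, Countable (a ⟶ b) := fun a b => by
    change Countable ((_ ⟶ _) ⊕ (_ ⟶ _))
    exact instCountableSum (α := @Quiver.Hom G.CatCarrier G.catQuiver a b)
      (β := @Quiver.Hom G.CatCarrier G.catQuiver b a)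
  haveI hSC : Countable (Quiver.Symmetrify G.CatCarrier) := hC
  -- paths, then their classes in the free groupoid (a quotient of the path category)
  have hp : Countable (@Quiver.Path (Quiver.Symmetrify G.CatCarrier)
      (@Quiver.symmetrifyQuiver G.CatCarrier G.catQuiver) x y) :=
    @countable_path _ (@Quiver.symmetrifyQuiver G.CatCarrier G.catQuiver) hSC hS x y
  exact Function.Surjective.countable
    (f := fun p : (@Quiver.Path (Quiver.Symmetrify G.CatCarrier)
        (@Quiver.symmetrifyQuiver G.CatCarrier G.catQuiver) x y) =>
      (CategoryTheory.Quotient.functor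
        (Quiver.FreeGroupoid.redStep (V := G.CatCarrier))).map p)
    (CategoryTheory.Quotient.full_functor _).map_surjective

/-- The topological fundamental group `π₁(𝔾, c)` of a countable semi-graph is countable.
[cite: MochizukiSemiAnbd2006, §1 p.15] -/
theorem countable_fundamentalGroup (G : SemiGraph.{u}) (hG : G.IsCountable) (c : G.CatCarrier) :
    Countable (G.FundamentalGroup c) :=
  G.countable_hom_fundamentalGroupoid hG c c

end SemiGraph

end Literature.AnabelianGeometry.SemiGraphs
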